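import Literature.Analysis.FluidPDE.SuitableWeak
import Literature.Analysis.FluidPDE.WeakSolution
import Literature.Analysis.FluidPDE.Seregin2023.TypeIIEulerZoom
import Summits.NavierStokesRegularity.NavierStokesRegularity.Theses.EulerZoomLiouville
import HarnessLib

/-!
# Rung A of the crux `EulerZoomLiouville.PowerGaugeEulerLiouville` — the energy-subcritical half `ρ > 1/2`

Route `EulerZoomLiouville` (NavierStokesRegularity), crux E = stmt-NavierStokesRegularity-19832
`PowerGaugeEulerLiouville`: an ancient local-energy Euler flow `(u, p)` on `(−∞, 0) × ℝ³` (suitable weak,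
`ν = 0`, `f = 0`, weak spatial gradient `H`) whose power-gauged CKN quantities at the origin obey Seregin's
bound `a^{2ρ} A(a) + a^{ρ} E(a) + a^{2ρ} D(a) ≤ c` for all `a > 0` vanishes a.e.  This file lands the
birth skeleton's STUB 1 (`Lines/birth.lean`, `Sig.stub_largeRho`; the planners' BC5 rung A, proved
sorry-free at birth in `bc/PowerGaugeEulerLiouville_rung.lean` by planner-ns-plan-lens-oqh-typeII-g0 — adapted
here verbatim, only the namespace and the packaging changed):

* `powerGaugeEulerLiouville_largeRho` — the crux VERBATIM for every `ρ > 1/2`.  Proof: the energy part of the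
  gauge, `a^{2ρ} · a⁻¹ ∫_{B(a)} |u(τ)|² ≤ c` for `τ ∈ (−a², 0)`, is the tree's
  `Seregin2023.HasScaledLocalEnergyBound (1 − 2ρ) c u` with `1 − 2ρ < 0`; the tree's energy Liouville
  theorem `Seregin2023.lintegral_enorm_sq_eq_zero_of_scaledLocalEnergyBound` [Seregin2023 §3 p.10, `m < 1/2`]
  kills every time slice; Tonelli on the slab (measurability from the weak-gradient structure) gives `u = 0`
  a.e.  The Euler system, the pressure and the `E`-gauge are not used.
* `stub_largeRho` — the same in the registered stub's binder shape (the three class hypotheses as one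
  conjunction, = `Sig.stub_largeRho` with the reducible `InClass` unfolded), so that the skeleton's stub 1 is
  `exact stub_largeRho`.
* `powerGaugeEulerLiouville_iff_window` — bookkeeping for the lead: the crux is EQUIVALENT to its restriction
  to the window `0 < ρ ≤ 1/2` (the half `ρ > 1/2` being this file).

WHAT THIS IS NOT: not NS regularity and not the crux — the crux stays OPEN on the window `0 < ρ ≤ 1/2`, which
contains the Chae–Shvydkoy window for self-similar Euler collapse (`α = 1 + ρ ∈ (1, 3/2]`); this is its FLOOR
rung (critic-2 K-READ 01: "energy-gaining half, arithmetic of the `A`-weight"). [folklore]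
-/

noncomputable section

-- the summit and its single problem share the name `NavierStokesRegularity` (D-0017 nested layout)
set_option linter.dupNamespace false

open MeasureTheory Set Filter Topology Metric Function
open scoped ENNReal NNReal

namespace Summit.NavierStokesRegularity.NavierStokesRegularity.Theorems.PowerGaugeEulerLiouville

open Literature.Analysis Literature.Analysis.FluidPDE

/-- **Rung A: the crux `PowerGaugeEulerLiouville` for `ρ > 1/2`** (energy Liouville).  For `ρ > 1/2`, every
ancient suitable weak Euler flow on `(−∞,0) × ℝ³` in Seregin's power-gauged class vanishes a.e.: the `A`-gauge
alone gives `∫_{B(a)} |u(τ)|² ≤ c a^{1−2ρ} → 0` (`a → ∞`) for every `τ ∈ (−a², 0)` [Seregin2023 §3 p.10].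
Adapted from the planners' birth rung `bc/PowerGaugeEulerLiouville_rung.lean` (sorry-free). [folklore] -/
theorem powerGaugeEulerLiouville_largeRho :
    ∀ ρ : ℝ, 1 / 2 < ρ → ∀ (u : ℝ → EuclideanSpace ℝ (Fin 3) → EuclideanSpace ℝ (Fin 3))
      (p : ℝ → EuclideanSpace ℝ (Fin 3) → ℝ)
      (H : ℝ → EuclideanSpace ℝ (Fin 3) → EuclideanSpace ℝ (Fin 3) →L[ℝ] EuclideanSpace ℝ (Fin 3)) (c : ℝ≥0),
      IsSuitableWeakSolutionOn (slab (EuclideanSpace ℝ (Fin 3)) (Set.Iio 0) isOpen_Iio) 0 0 u p →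
      HasWeakSpatialGradientOn (slab (EuclideanSpace ℝ (Fin 3)) (Set.Iio 0) isOpen_Iio) u H →
      (∀ a : ℝ, 0 < a → ENNReal.ofReal (a ^ (2 * ρ)) * cknA a (0 : ℝ × EuclideanSpace ℝ (Fin 3)) u +
        ENNReal.ofReal (a ^ ρ) * cknE a (0 : ℝ × EuclideanSpace ℝ (Fin 3)) H +
        ENNReal.ofReal (a ^ (2 * ρ)) * cknD a (0 : ℝ × EuclideanSpace ℝ (Fin 3)) p ≤ (c : ℝ≥0∞)) →
      Function.uncurry u =ᵐ[volume.restrict (Set.Iio (0 : ℝ) ×ˢ (Set.univ : Set (EuclideanSpace ℝ (Fin 3))))] 0 := by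
  intro ρ hρ u p H c _hsw hH hc
  -- adapted from bc/PowerGaugeEulerLiouville_rung.lean (planner-ns-plan-lens-oqh-typeII-g0, birth package)
  -- Step 1: the energy part of the gauge bound is a scaled local-energy bound with exponent 1 - 2ρ < 0.
  have hA : Literature.Analysis.FluidPDE.Seregin2023.HasScaledLocalEnergyBound (1 - 2 * ρ) c u := by
    intro a ha s hs
    have h1 := hc a ha
    -- isolate the A-term
    have hAterm : ENNReal.ofReal (a ^ (2 * ρ)) *
        Literature.Analysis.FluidPDE.cknA a (0 : ℝ × EuclideanSpace ℝ (Fin 3)) u ≤ (c : ℝ≥0∞) :=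
      le_trans (le_trans le_self_add le_self_add) h1
    -- the slice at time s is below the supremum defining cknA
    have hslice : (ENNReal.ofReal a)⁻¹ * ∫⁻ x in ball (0 : EuclideanSpace ℝ (Fin 3)) a, ‖u s x‖ₑ ^ 2 ≤
        Literature.Analysis.FluidPDE.cknA a (0 : ℝ × EuclideanSpace ℝ (Fin 3)) u := by
      unfold Literature.Analysis.FluidPDE.cknA
      have hs' : s ∈ Ioo ((0 : ℝ × EuclideanSpace ℝ (Fin 3)).1 - a ^ 2) (0 : ℝ × EuclideanSpace ℝ (Fin 3)).1 := by
        simpa using hs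
      exact le_iSup₂ (f := fun t (_ : t ∈ Ioo ((0 : ℝ × EuclideanSpace ℝ (Fin 3)).1 - a ^ 2)
          (0 : ℝ × EuclideanSpace ℝ (Fin 3)).1) =>
          (ENNReal.ofReal a)⁻¹ * ∫⁻ x in ball (0 : ℝ × EuclideanSpace ℝ (Fin 3)).2 a, ‖u t x‖ₑ ^ 2) s hs'
    have hB0 : ENNReal.ofReal (a ^ (2 * ρ)) ≠ 0 := by
      rw [ENNReal.ofReal_ne_zero_iff]; exact Real.rpow_pos_of_pos ha _
    have hBtop : ENNReal.ofReal (a ^ (2 * ρ)) ≠ ⊤ := ENNReal.ofReal_ne_top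
    have hA0 : ENNReal.ofReal a ≠ 0 := by rw [ENNReal.ofReal_ne_zero_iff]; exact ha
    have hAtop : ENNReal.ofReal a ≠ ⊤ := ENNReal.ofReal_ne_top
    have h2 : ENNReal.ofReal (a ^ (2 * ρ)) *
        ((ENNReal.ofReal a)⁻¹ * ∫⁻ x in ball (0 : EuclideanSpace ℝ (Fin 3)) a, ‖u s x‖ₑ ^ 2) ≤ (c : ℝ≥0∞) :=
      le_trans (mul_le_mul_right hslice _) hAterm
    -- unscale
    have h3 : ∫⁻ x in ball (0 : EuclideanSpace ℝ (Fin 3)) a, ‖u s x‖ₑ ^ 2 ≤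
        ENNReal.ofReal a * (ENNReal.ofReal (a ^ (2 * ρ)))⁻¹ * (c : ℝ≥0∞) := by
      have key : ∫⁻ x in ball (0 : EuclideanSpace ℝ (Fin 3)) a, ‖u s x‖ₑ ^ 2 =
          ENNReal.ofReal a * (ENNReal.ofReal (a ^ (2 * ρ)))⁻¹ *
            (ENNReal.ofReal (a ^ (2 * ρ)) *
              ((ENNReal.ofReal a)⁻¹ * ∫⁻ x in ball (0 : EuclideanSpace ℝ (Fin 3)) a, ‖u s x‖ₑ ^ 2)) := by
        rw [← mul_assoc, mul_assoc (ENNReal.ofReal a), ENNReal.inv_mul_cancel hB0 hBtop, mul_one,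
          ← mul_assoc, ENNReal.mul_inv_cancel hA0 hAtop, one_mul]
      rw [key]
      exact mul_le_mul_right h2 _
    refine le_trans h3 (le_of_eq ?_)
    rw [← ENNReal.ofReal_inv_of_pos (Real.rpow_pos_of_pos ha _), ← ENNReal.ofReal_mul ha.le,
      ENNReal.coe_nnreal_eq, ← ENNReal.ofReal_mul (by positivity)]
    congr 1
    rw [mul_comm, Real.rpow_sub ha, Real.rpow_one, div_eq_mul_inv]
  -- Step 2: every slice has zero energy (no measurability needed).
  have hslice0 : ∀ s : ℝ, s < 0 → ∫⁻ y, ‖u s y‖ₑ ^ 2 = 0 := fun s hs =>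
    Literature.Analysis.FluidPDE.Seregin2023.lintegral_enorm_sq_eq_zero_of_scaledLocalEnergyBound
      (m₁ := 1 - 2 * ρ) (by linarith) hA hs
  -- Step 3: Tonelli on the slab.
  have hmeas : AEStronglyMeasurable (Function.uncurry u)
      (volume.restrict (Set.Iio (0 : ℝ) ×ˢ (Set.univ : Set (EuclideanSpace ℝ (Fin 3))))) := by
    have := hH.locallyIntegrableOn.aestronglyMeasurable
    simpa [Literature.Analysis.FluidPDE.slab] using this
  have hint : ∫⁻ z in Set.Iio (0 : ℝ) ×ˢ (Set.univ : Set (EuclideanSpace ℝ (Fin 3))),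
      ‖Function.uncurry u z‖ₑ ^ 2 = 0 := by
    rw [Measure.volume_eq_prod, ← Measure.prod_restrict, Measure.restrict_univ,
      lintegral_prod _ (by
        have hm := hmeas.aemeasurable.enorm.pow_const 2
        rw [Measure.volume_eq_prod, ← Measure.prod_restrict, Measure.restrict_univ] at hm
        exact hm)]
    have hzero : (fun s : ℝ => ∫⁻ y, ‖Function.uncurry u (s, y)‖ₑ ^ 2) =ᵐ[volume.restrict (Iio 0)] 0 := by
      rw [EventuallyEq, ae_restrict_iff' measurableSet_Iio]
      exact ae_of_all _ (fun s hs => by simpa [Function.uncurry] using hslice0 s hs)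
    rw [lintegral_congr_ae hzero]; simp
  have hae : (fun z => ‖Function.uncurry u z‖ₑ ^ 2) =ᵐ[volume.restrict
      (Set.Iio (0 : ℝ) ×ˢ (Set.univ : Set (EuclideanSpace ℝ (Fin 3))))] 0 :=
    (lintegral_eq_zero_iff' (hmeas.aemeasurable.enorm.pow_const 2)).1 hint
  filter_upwards [hae] with z hz
  have hz' : ‖Function.uncurry u z‖ₑ ^ 2 = 0 := hz
  rwa [pow_eq_zero_iff two_ne_zero, enorm_eq_zero] at hz'


/-- **Stub 1 of the birth skeleton, in its registered binder shape** (`Sig.stub_largeRho` of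
`Cruxes/PowerGaugeEulerLiouville/Lines/birth.lean` with the reducible `InClass` unfolded: the three class
hypotheses as one conjunction). [folklore] -/
theorem stub_largeRho :
    ∀ ρ : ℝ, 1 / 2 < ρ → ∀ (u : ℝ → EuclideanSpace ℝ (Fin 3) → EuclideanSpace ℝ (Fin 3))
      (p : ℝ → EuclideanSpace ℝ (Fin 3) → ℝ)
      (H : ℝ → EuclideanSpace ℝ (Fin 3) → EuclideanSpace ℝ (Fin 3) →L[ℝ] EuclideanSpace ℝ (Fin 3)) (c : ℝ≥0),
      (IsSuitableWeakSolutionOn (slab (EuclideanSpace ℝ (Fin 3)) (Set.Iio 0) isOpen_Iio) 0 0 u p ∧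
        HasWeakSpatialGradientOn (slab (EuclideanSpace ℝ (Fin 3)) (Set.Iio 0) isOpen_Iio) u H ∧
        (∀ a : ℝ, 0 < a → ENNReal.ofReal (a ^ (2 * ρ)) * cknA a (0 : ℝ × EuclideanSpace ℝ (Fin 3)) u +
          ENNReal.ofReal (a ^ ρ) * cknE a (0 : ℝ × EuclideanSpace ℝ (Fin 3)) H +
          ENNReal.ofReal (a ^ (2 * ρ)) * cknD a (0 : ℝ × EuclideanSpace ℝ (Fin 3)) p ≤ (c : ℝ≥0∞))) →
      Function.uncurry u =ᵐ[volume.restrict (Set.Iio (0 : ℝ) ×ˢ (Set.univ : Set (EuclideanSpace ℝ (Fin 3))))] 0 :=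
  fun ρ hρ u p H c h => powerGaugeEulerLiouville_largeRho ρ hρ u p H c h.1 h.2.1 h.2.2

/-- **The crux reduces to the window `0 < ρ ≤ 1/2`.**  `PowerGaugeEulerLiouville` (all `ρ > 0`) holds iff it
holds for `0 < ρ ≤ 1/2`; the other half is `powerGaugeEulerLiouville_largeRho`. [folklore] -/
theorem powerGaugeEulerLiouville_iff_window :
    Summit.NavierStokesRegularity.NavierStokesRegularity.Theses.EulerZoomLiouville.PowerGaugeEulerLiouville ↔
    ∀ ρ : ℝ, 0 < ρ → ρ ≤ 1 / 2 → ∀ (u : ℝ → EuclideanSpace ℝ (Fin 3) → EuclideanSpace ℝ (Fin 3))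
      (p : ℝ → EuclideanSpace ℝ (Fin 3) → ℝ)
      (H : ℝ → EuclideanSpace ℝ (Fin 3) → EuclideanSpace ℝ (Fin 3) →L[ℝ] EuclideanSpace ℝ (Fin 3)) (c : ℝ≥0),
      IsSuitableWeakSolutionOn (slab (EuclideanSpace ℝ (Fin 3)) (Set.Iio 0) isOpen_Iio) 0 0 u p →
      HasWeakSpatialGradientOn (slab (EuclideanSpace ℝ (Fin 3)) (Set.Iio 0) isOpen_Iio) u H →
      (∀ a : ℝ, 0 < a → ENNReal.ofReal (a ^ (2 * ρ)) * cknA a (0 : ℝ × EuclideanSpace ℝ (Fin 3)) u +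
        ENNReal.ofReal (a ^ ρ) * cknE a (0 : ℝ × EuclideanSpace ℝ (Fin 3)) H +
        ENNReal.ofReal (a ^ (2 * ρ)) * cknD a (0 : ℝ × EuclideanSpace ℝ (Fin 3)) p ≤ (c : ℝ≥0∞)) →
      Function.uncurry u =ᵐ[volume.restrict (Set.Iio (0 : ℝ) ×ˢ (Set.univ : Set (EuclideanSpace ℝ (Fin 3))))] 0 := by
  constructor
  · intro h ρ hρ _ u p H c hsw hH hc
    exact h ρ hρ u p H c hsw hH hc
  · intro h ρ hρ u p H c hsw hH hc
    by_cases hhalf : 1 / 2 < ρ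
    · exact powerGaugeEulerLiouville_largeRho ρ hhalf u p H c hsw hH hc
    · exact h ρ hρ (not_lt.mp hhalf) u p H c hsw hH hc

end Summit.NavierStokesRegularity.NavierStokesRegularity.Theorems.PowerGaugeEulerLiouville

end
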